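import Summits.SmoothPoincare4.SmoothPoincare4.Theses.InformationMetricHadamard

/-!
# Line `Sketch` — skeleton for crux `InformationMetricHadamard.C0AhRecognition`

(item stmt-SmoothPoincare4-6015, route `InformationMetricHadamard`, rank 3; idea card
`Cruxes/C0AhRecognition/Ideas/liouville-conformal-infinity.md`, planner sketch attached as evidence
`20260816T144528Z-Sketch.lean` — not mounted in the lead's jail, so the skeleton is RECONSTRUCTED from
the card's typed description; skeleton owned by the line lead `prover-line-stmt-SmoothPoincare4-6015-0`,
2026-08-16.)

Crux (fixed, never restated): if a homotopy 4-sphere `Σ`, with a Riemannian metric `g`, is the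
cross-section of a proper end collar `Φ : Σ × (0,1) → W` of a Cartan–Hadamard 5-manifold `(W, G)`
(complete, simply connected, `sec ≤ 0`) on which `G` is `C⁰`-asymptotic to `c (dλ² + g)/λ²`, then
`Σ ≅ S⁴`.

## The line: Liouville at infinity

Registered stubs (all collar clauses written out verbatim, no auxiliary definition; reshape r1 carves
the two provable collar lemmas A, C out of the first lemma, which consumes their conclusions):

* `stub_farCollarImmersive` (A; S; LANDED p110749): the `C⁰`-asymptotics force `dΨ` injective on
  `N × (0,t)` for some `t` (take `ε = 1/2`: `G(dΨ u, dΨ u) ≥ c (s² + gN(v,v)) / (2 l²) > 0` for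
  `u = (v,s) ≠ 0`).
* `stub_farCollarIsFar` (C; L; LANDED p112347): deep collar points are metrically far: for every `x₀` and `R`
  there is `t` with `d_G(x₀, Ψ(y,l)) > R` whenever `l < t` (exit-time argument: a `C¹` path from
  `Ψ(y,l)` to `x₀` must climb the collar, and `|γ'|_G ≥ √(c/2) |(log λ)'|` along it).
* `stub_twoCollarConformality` (first lemma, given A and C for both collars; XXL formally — wave 1 REDUCED it,
  kernel-checked, to two unfiled quasiconformal facts F2 `OneQuasiconformalRegularity` (Gehring +
  Lelong-Ferrand) and F3 `AsymptoticallyConformalEndExtension` (Väisälä/GMRV) on a definition request F1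
  `metricDilatation`: `Lines/SketchTwoCollarConformalityMemo.lean`, `Lines/SketchTwoCollarTransition.lean`): two
  `C⁰`-cone collars of the same complete Riemannian 5-manifold `W`, over closed Riemannian
  4-manifolds `(Σ, g)` (a homotopy sphere) and `(N, gN)`, force `Σ ≅ N` (the transition map is
  pointwise `(1+o(1))`-quasiconformal between the two
  cone ends, so the boundary correspondence has metric dilatation `H ≡ 1`, is 1-quasiconformal
  (Gehring 1962), hence a `C^∞` conformal diffeomorphism (Liouville–Reshetnyak; Lelong-Ferrand 1979)).
* `stub_standardSectionConeCollar` (transfer `C⁺`; crux-sized): under exactly the hypotheses of the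
  crux, the end of `W` carries SOME `C⁰`-cone collar whose cross-section is the round `S⁴ ⊂ ℝ⁵` with
  some Riemannian metric `gN` and some constant `c'`.

Proved here (no `sorry` of its own): `C0AhRecognition_of` (the crux BY NAME from the four stubs).

## Disproof.lean honoured

None exists for this crux yet (`ledger crux ls stmt-SmoothPoincare4-6015`, 2026-08-16T14:55Z: Ideas only;
payload `disproof_path` is another seat's folder, not mounted). The standing negative evidence is the
refuter's TwistNote.md (evidence on the item): this line never asks a slice, sphere or sublevel set to be
convex or graphical, so TwistNote's swirled metric is not a counterexample to either stub (its original
polar collar satisfies `stub_standardSectionConeCollar`, and its boundary map is Möbius).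
-/

noncomputable section

-- the prescribed namespace `Summit.<P>.<Sub>.…` duplicates `SmoothPoincare4` (P = Sub)
set_option linter.dupNamespace false

open scoped Manifold ContDiff Topology ENNReal NNReal
open Set Function

namespace Summit.SmoothPoincare4.SmoothPoincare4.Cruxes.C0AhRecognition.Sketch

open Literature.Topology.FourManifolds (HomotopySphere)
open Literature.Geometry.Lorentzian (PseudoRiemannianMetric)

/-! ## Stub A — the C⁰-asymptotics make the collar immersive far out (LANDED) -/

/-- **Stub A (`farCollarImmersive`) — LANDED as p110749**, tree file
`Theorems/InformationMetricHadamardC0AhRecognitionStubFarCollarImmersive.lean` (wave 1, same name and namespace).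
This sorried copy stands in only until the farm has built that module; then replace it by the
`import` (the lead's folder copy `work/C0AhRecognition.lean` already does). Statement: the asymptotics
clause with `c > 0` and `gN` Riemannian forces `dΨ` injective on `N × (0,t)` for some `t`. [folklore] -/
theorem stub_farCollarImmersive
    (N : Type) [TopologicalSpace N] [ChartedSpace (EuclideanSpace ℝ (Fin 4)) N] [IsManifold (𝓡 4) ∞ N]
    (gN : PseudoRiemannianMetric (𝓡 4) ∞ (EuclideanSpace ℝ (Fin 4)) (TangentSpace (𝓡 4) : N → Type _))
    (hgN : gN.IsRiemannian)
    (W : Type) [TopologicalSpace W] [ChartedSpace (EuclideanSpace ℝ (Fin 5)) W] [IsManifold (𝓡 5) ∞ W]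
    (G : PseudoRiemannianMetric (𝓡 5) ∞ (EuclideanSpace ℝ (Fin 5)) (TangentSpace (𝓡 5) : W → Type _))
    (c : ℝ) (Ψ : N × ℝ → W) (hc : 0 < c)
    (hasym : ∀ ε : ℝ, 0 < ε → ∃ t ∈ Ioo (0 : ℝ) 1, ∀ (y : N) (l : ℝ), l ∈ Ioo (0 : ℝ) t →
      ∀ (v : TangentSpace (𝓡 4) y) (s : ℝ),
        |G.val (Ψ (y, l)) (mfderiv ((𝓡 4).prod 𝓘(ℝ, ℝ)) (𝓡 5) Ψ (y, l) (v, s))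
            (mfderiv ((𝓡 4).prod 𝓘(ℝ, ℝ)) (𝓡 5) Ψ (y, l) (v, s)) -
          c * (s ^ 2 + gN.val y v v) / l ^ 2| ≤ ε * (c * (s ^ 2 + gN.val y v v) / l ^ 2)) :
    ∃ t ∈ Ioo (0 : ℝ) 1, ∀ (y : N) (l : ℝ), l ∈ Ioo (0 : ℝ) t →
      Injective (mfderiv ((𝓡 4).prod 𝓘(ℝ, ℝ)) (𝓡 5) Ψ (y, l)) := by
  sorry  -- LANDED p110749 (see docstring); stand-in until the farm builds the module

/-! ## Stub C — deep collar points are metrically far (LANDED) -/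

/-- **Stub C (`farCollarIsFar`) — LANDED as p112347**, tree file
`Theorems/InformationMetricHadamardC0AhRecognitionStubFarCollarIsFar.lean` (wave 1, 390 lines, same name and namespace).
This sorried copy stands in only until the farm has built that module; then replace it by
`import Summits.SmoothPoincare4.SmoothPoincare4.Theorems.InformationMetricHadamardC0AhRecognitionStubFarCollarIsFar`
(the lead's folder copy `work/C0AhRecognition.lean` already does). Statement: for a `C⁰`-cone collar
`Ψ : N × (0,1) → W` over a compact `N`, for every `x₀ ∈ W` and `R ≥ 0` there is `t ∈ (0,1)` with
`d_G(x₀, Ψ(y,l)) > R` for all `y` and all `l < t`. [folklore] -/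
theorem stub_farCollarIsFar
    (N : Type) [TopologicalSpace N] [T2Space N] [SecondCountableTopology N] [CompactSpace N]
    [ChartedSpace (EuclideanSpace ℝ (Fin 4)) N] [IsManifold (𝓡 4) ∞ N]
    (gN : PseudoRiemannianMetric (𝓡 4) ∞ (EuclideanSpace ℝ (Fin 4)) (TangentSpace (𝓡 4) : N → Type _))
    (hgN : gN.IsRiemannian)
    (W : Type) [TopologicalSpace W] [T2Space W] [SecondCountableTopology W]
    [ChartedSpace (EuclideanSpace ℝ (Fin 5)) W] [IsManifold (𝓡 5) ∞ W]
    (G : PseudoRiemannianMetric (𝓡 5) ∞ (EuclideanSpace ℝ (Fin 5)) (TangentSpace (𝓡 5) : W → Type _))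
    (hG : G.IsRiemannian)
    (c : ℝ) (Ψ : N × ℝ → W) (hc : 0 < c)
    (hsm : ContMDiffOn ((𝓡 4).prod 𝓘(ℝ, ℝ)) (𝓡 5) ∞ Ψ (univ ×ˢ Ioo (0 : ℝ) 1))
    (hinj : InjOn Ψ (univ ×ˢ Ioo (0 : ℝ) 1))
    (himm : ∃ t₀ ∈ Ioo (0 : ℝ) 1, ∀ (y : N) (l : ℝ), l ∈ Ioo (0 : ℝ) t₀ →
      Injective (mfderiv ((𝓡 4).prod 𝓘(ℝ, ℝ)) (𝓡 5) Ψ (y, l)))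
    (hasym : ∀ ε : ℝ, 0 < ε → ∃ t ∈ Ioo (0 : ℝ) 1, ∀ (y : N) (l : ℝ), l ∈ Ioo (0 : ℝ) t →
      ∀ (v : TangentSpace (𝓡 4) y) (s : ℝ),
        |G.val (Ψ (y, l)) (mfderiv ((𝓡 4).prod 𝓘(ℝ, ℝ)) (𝓡 5) Ψ (y, l) (v, s))
            (mfderiv ((𝓡 4).prod 𝓘(ℝ, ℝ)) (𝓡 5) Ψ (y, l) (v, s)) -
          c * (s ^ 2 + gN.val y v v) / l ^ 2| ≤ ε * (c * (s ^ 2 + gN.val y v v) / l ^ 2)) :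
    ∀ (x₀ : W) (R : NNReal), ∃ t ∈ Ioo (0 : ℝ) 1, ∀ (y : N) (l : ℝ), l ∈ Ioo (0 : ℝ) t →
      (R : ℝ≥0∞) < G.edist hG x₀ (Ψ (y, l)) := by
  sorry  -- LANDED p112347 (see docstring); stand-in until the farm builds the module

/-! ## Stub 1 — two C⁰-cone collars of one end have conformally equivalent cross-sections -/

/-- **Stub `TwoCollarConformality` (Liouville at infinity).** Let `(W, G)` be a complete Riemannian
5-manifold, `(Σ, g)` a Riemannian homotopy 4-sphere and `(N, gN)` a closed Riemannian 4-manifold. If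
`Φ : Σ × (0,1) → W` and `Ψ : N × (0,1) → W` are both `C⁰`-cone collars of `W` — smooth and injective,
far parts co-compact with closure inside the collar, and `G ∘ dΦ = (1 + o(1)) c (dλ² + g)/λ²`,
`G ∘ dΨ = (1 + o(1)) c' (dμ² + gN)/μ²` uniformly as `λ, μ → 0` — then `Σ ≅ N`. The
conclusions of stubs A and C for both collars (immersive far out; deep points far) are supplied as
hypotheses `himmΦ hfarΦ himmΨ hfarΨ`. Mechanism: `Ψ⁻¹ ∘ Φ` is defined far out and is pointwise `(1+o(1))`-quasiconformal between the cone
metrics; its boundary correspondence `Σ → N` has metric dilatation `H ≡ 1` (Mostow-type localisation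
with multiplicative-only error), is 1-quasiconformal (Gehring, TAMS 103 (1962)), hence a smooth conformal
diffeomorphism `(Σ,[g]) → (N,[gN])` (Liouville–Reshetnyak; J. Lelong-Ferrand, LNM 743 (1979)). -/
theorem stub_twoCollarConformality
    (S : HomotopySphere 4)
    (g : PseudoRiemannianMetric (𝓡 4) ∞ (EuclideanSpace ℝ (Fin 4)) (TangentSpace (𝓡 4) : S.carrier → Type _))
    (hg : g.IsRiemannian)
    (N : Type) [TopologicalSpace N] [T2Space N] [SecondCountableTopology N] [CompactSpace N]
    [ChartedSpace (EuclideanSpace ℝ (Fin 4)) N] [IsManifold (𝓡 4) ∞ N]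
    (gN : PseudoRiemannianMetric (𝓡 4) ∞ (EuclideanSpace ℝ (Fin 4)) (TangentSpace (𝓡 4) : N → Type _))
    (hgN : gN.IsRiemannian)
    (W : Type) [TopologicalSpace W] [T2Space W] [SecondCountableTopology W]
    [ChartedSpace (EuclideanSpace ℝ (Fin 5)) W] [IsManifold (𝓡 5) ∞ W]
    (G : PseudoRiemannianMetric (𝓡 5) ∞ (EuclideanSpace ℝ (Fin 5)) (TangentSpace (𝓡 5) : W → Type _))
    (hG : G.IsRiemannian)
    (hcpt : ∀ (x : W) (r : NNReal), IsCompact {y : W | G.edist hG x y ≤ r})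
    (c : ℝ) (Φ : S.carrier × ℝ → W) (hc : 0 < c)
    (hsm : ContMDiffOn ((𝓡 4).prod 𝓘(ℝ, ℝ)) (𝓡 5) ∞ Φ (univ ×ˢ Ioo (0 : ℝ) 1))
    (hinj : InjOn Φ (univ ×ˢ Ioo (0 : ℝ) 1))
    (hco : ∀ t ∈ Ioo (0 : ℝ) 1, IsCompact (Φ '' (univ ×ˢ Ioo (0 : ℝ) t))ᶜ)
    (hcl : ∀ t ∈ Ioo (0 : ℝ) 1, closure (Φ '' (univ ×ˢ Ioo (0 : ℝ) t)) ⊆ Φ '' (univ ×ˢ Ioo (0 : ℝ) 1))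
    (hasym : ∀ ε : ℝ, 0 < ε → ∃ t ∈ Ioo (0 : ℝ) 1, ∀ (x : S.carrier) (l : ℝ), l ∈ Ioo (0 : ℝ) t →
      ∀ (v : TangentSpace (𝓡 4) x) (s : ℝ),
        |G.val (Φ (x, l)) (mfderiv ((𝓡 4).prod 𝓘(ℝ, ℝ)) (𝓡 5) Φ (x, l) (v, s))
            (mfderiv ((𝓡 4).prod 𝓘(ℝ, ℝ)) (𝓡 5) Φ (x, l) (v, s)) -
          c * (s ^ 2 + g.val x v v) / l ^ 2| ≤ ε * (c * (s ^ 2 + g.val x v v) / l ^ 2))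
    (himmΦ : ∃ t₀ ∈ Ioo (0 : ℝ) 1, ∀ (x : S.carrier) (l : ℝ), l ∈ Ioo (0 : ℝ) t₀ →
      Injective (mfderiv ((𝓡 4).prod 𝓘(ℝ, ℝ)) (𝓡 5) Φ (x, l)))
    (hfarΦ : ∀ (x₀ : W) (R : NNReal), ∃ t ∈ Ioo (0 : ℝ) 1, ∀ (x : S.carrier) (l : ℝ),
      l ∈ Ioo (0 : ℝ) t → (R : ℝ≥0∞) < G.edist hG x₀ (Φ (x, l)))
    (c' : ℝ) (Ψ : N × ℝ → W) (hc' : 0 < c')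
    (hsm' : ContMDiffOn ((𝓡 4).prod 𝓘(ℝ, ℝ)) (𝓡 5) ∞ Ψ (univ ×ˢ Ioo (0 : ℝ) 1))
    (hinj' : InjOn Ψ (univ ×ˢ Ioo (0 : ℝ) 1))
    (hco' : ∀ t ∈ Ioo (0 : ℝ) 1, IsCompact (Ψ '' (univ ×ˢ Ioo (0 : ℝ) t))ᶜ)
    (hcl' : ∀ t ∈ Ioo (0 : ℝ) 1, closure (Ψ '' (univ ×ˢ Ioo (0 : ℝ) t)) ⊆ Ψ '' (univ ×ˢ Ioo (0 : ℝ) 1))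
    (hasym' : ∀ ε : ℝ, 0 < ε → ∃ t ∈ Ioo (0 : ℝ) 1, ∀ (y : N) (l : ℝ), l ∈ Ioo (0 : ℝ) t →
      ∀ (v : TangentSpace (𝓡 4) y) (s : ℝ),
        |G.val (Ψ (y, l)) (mfderiv ((𝓡 4).prod 𝓘(ℝ, ℝ)) (𝓡 5) Ψ (y, l) (v, s))
            (mfderiv ((𝓡 4).prod 𝓘(ℝ, ℝ)) (𝓡 5) Ψ (y, l) (v, s)) -
          c' * (s ^ 2 + gN.val y v v) / l ^ 2| ≤ ε * (c' * (s ^ 2 + gN.val y v v) / l ^ 2))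
    (himmΨ : ∃ t₀ ∈ Ioo (0 : ℝ) 1, ∀ (y : N) (l : ℝ), l ∈ Ioo (0 : ℝ) t₀ →
      Injective (mfderiv ((𝓡 4).prod 𝓘(ℝ, ℝ)) (𝓡 5) Ψ (y, l)))
    (hfarΨ : ∀ (x₀ : W) (R : NNReal), ∃ t ∈ Ioo (0 : ℝ) 1, ∀ (y : N) (l : ℝ),
      l ∈ Ioo (0 : ℝ) t → (R : ℝ≥0∞) < G.edist hG x₀ (Ψ (y, l))) :
    Nonempty (S.carrier ≃ₘ⟮𝓡 4, 𝓡 4⟯ N) := by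
  sorry

/-! ## Stub 2 — the end of `W` has a C⁰-cone collar with round-sphere cross-section -/

/-- **Stub `StandardSectionConeCollar` (transfer `C⁺`).** Under exactly the hypotheses of the crux —
`(W, G)` a Cartan–Hadamard 5-manifold (complete, simply connected, `sec ≤ 0`) with a `C⁰`-cone collar
`Φ` over a Riemannian homotopy 4-sphere `(Σ, g)` — the end of `W` carries a `C⁰`-cone collar
`Ψ : S⁴ × (0,1) → W` over the standard sphere `S⁴ ⊂ ℝ⁵` with SOME Riemannian metric `gN` and constant
`c' > 0` (same clauses: smooth, injective, far parts co-compact, closure inside the collar,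
`G ∘ dΨ = (1 + o(1)) c' (dμ² + gN)/μ²`). Equivalent to the crux given stub 1 (the converse direction is
`standardSectionConeCollar_of_c0AhRecognition`, transport along `Σ ≅ S⁴`); its content is an EXISTENCE
statement about one Riemannian 5-manifold, with `Σ` eliminated. -/
theorem stub_standardSectionConeCollar
    (S : HomotopySphere 4)
    (g : PseudoRiemannianMetric (𝓡 4) ∞ (EuclideanSpace ℝ (Fin 4)) (TangentSpace (𝓡 4) : S.carrier → Type _))
    (hg : g.IsRiemannian)
    (W : Type) [TopologicalSpace W] [T2Space W] [SecondCountableTopology W]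
    [ChartedSpace (EuclideanSpace ℝ (Fin 5)) W] [IsManifold (𝓡 5) ∞ W] [SimplyConnectedSpace W]
    (G : PseudoRiemannianMetric (𝓡 5) ∞ (EuclideanSpace ℝ (Fin 5)) (TangentSpace (𝓡 5) : W → Type _))
    (hG : G.IsRiemannian) (c : ℝ) (Φ : S.carrier × ℝ → W) (hc : 0 < c)
    (hcpt : ∀ (x : W) (r : NNReal), IsCompact {y : W | G.edist hG x y ≤ r})
    (hsec : ∀ cov, G.IsLeviCivita cov →
      ∀ (x : W) (X Y : TangentSpace (𝓡 5) x), G.sectionalCurvature cov x X Y ≤ 0)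
    (hsm : ContMDiffOn ((𝓡 4).prod 𝓘(ℝ, ℝ)) (𝓡 5) ∞ Φ (univ ×ˢ Ioo (0 : ℝ) 1))
    (hinj : InjOn Φ (univ ×ˢ Ioo (0 : ℝ) 1))
    (hco : ∀ t ∈ Ioo (0 : ℝ) 1, IsCompact (Φ '' (univ ×ˢ Ioo (0 : ℝ) t))ᶜ)
    (hcl : ∀ t ∈ Ioo (0 : ℝ) 1, closure (Φ '' (univ ×ˢ Ioo (0 : ℝ) t)) ⊆ Φ '' (univ ×ˢ Ioo (0 : ℝ) 1))
    (hasym : ∀ ε : ℝ, 0 < ε → ∃ t ∈ Ioo (0 : ℝ) 1, ∀ (x : S.carrier) (l : ℝ), l ∈ Ioo (0 : ℝ) t →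
      ∀ (v : TangentSpace (𝓡 4) x) (s : ℝ),
        |G.val (Φ (x, l)) (mfderiv ((𝓡 4).prod 𝓘(ℝ, ℝ)) (𝓡 5) Φ (x, l) (v, s))
            (mfderiv ((𝓡 4).prod 𝓘(ℝ, ℝ)) (𝓡 5) Φ (x, l) (v, s)) -
          c * (s ^ 2 + g.val x v v) / l ^ 2| ≤ ε * (c * (s ^ 2 + g.val x v v) / l ^ 2)) :
    ∃ (gN : PseudoRiemannianMetric (𝓡 4) ∞ (EuclideanSpace ℝ (Fin 4))
        (TangentSpace (𝓡 4) : (Metric.sphere (0 : EuclideanSpace ℝ (Fin 5)) 1) → Type _))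
      (_ : gN.IsRiemannian) (c' : ℝ) (Ψ : (Metric.sphere (0 : EuclideanSpace ℝ (Fin 5)) 1) × ℝ → W),
      0 < c' ∧
      ContMDiffOn ((𝓡 4).prod 𝓘(ℝ, ℝ)) (𝓡 5) ∞ Ψ (univ ×ˢ Ioo (0 : ℝ) 1) ∧
      InjOn Ψ (univ ×ˢ Ioo (0 : ℝ) 1) ∧
      (∀ t ∈ Ioo (0 : ℝ) 1, IsCompact (Ψ '' (univ ×ˢ Ioo (0 : ℝ) t))ᶜ) ∧
      (∀ t ∈ Ioo (0 : ℝ) 1, closure (Ψ '' (univ ×ˢ Ioo (0 : ℝ) t)) ⊆ Ψ '' (univ ×ˢ Ioo (0 : ℝ) 1)) ∧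
      (∀ ε : ℝ, 0 < ε → ∃ t ∈ Ioo (0 : ℝ) 1,
        ∀ (y : (Metric.sphere (0 : EuclideanSpace ℝ (Fin 5)) 1)) (l : ℝ), l ∈ Ioo (0 : ℝ) t →
        ∀ (v : TangentSpace (𝓡 4) y) (s : ℝ),
          |G.val (Ψ (y, l)) (mfderiv ((𝓡 4).prod 𝓘(ℝ, ℝ)) (𝓡 5) Ψ (y, l) (v, s))
              (mfderiv ((𝓡 4).prod 𝓘(ℝ, ℝ)) (𝓡 5) Ψ (y, l) (v, s)) -
            c' * (s ^ 2 + gN.val y v v) / l ^ 2| ≤ ε * (c' * (s ^ 2 + gN.val y v v) / l ^ 2)) := by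
  sorry

/-! ## The composition (kernel-checked; no `sorry` of its own) -/

/-- **The line concludes the crux BY NAME.** Stub 2 supplies a second `C⁰`-cone collar of the same
end with cross-section the round `S⁴`; stubs A and C, applied to both collars, give far
immersivity and metric depth; stub 1 (with `N = S⁴`) turns the pair of collars into a
diffeomorphism `Σ ≅ S⁴`. -/
theorem C0AhRecognition_of :
    Summit.SmoothPoincare4.SmoothPoincare4.Theses.InformationMetricHadamard.C0AhRecognition := by
  intro S g hg W _ _ _ _ _ _ G hG c Φ hc hcpt hsec hsm hinj hco hcl hasym
  obtain ⟨gN, hgN, c', Ψ, hc', hsm', hinj', hco', hcl', hasym'⟩ :=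
    stub_standardSectionConeCollar S g hg W G hG c Φ hc hcpt hsec hsm hinj hco hcl hasym
  have himmΦ := stub_farCollarImmersive S.carrier g hg W G c Φ hc hasym
  have hfarΦ := stub_farCollarIsFar S.carrier g hg W G hG c Φ hc hsm hinj himmΦ hasym
  have himmΨ := stub_farCollarImmersive (Metric.sphere (0 : EuclideanSpace ℝ (Fin 5)) 1) gN hgN
    W G c' Ψ hc' hasym'
  have hfarΨ := stub_farCollarIsFar (Metric.sphere (0 : EuclideanSpace ℝ (Fin 5)) 1) gN hgN
    W G hG c' Ψ hc' hsm' hinj' himmΨ hasym'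
  exact stub_twoCollarConformality S g hg (Metric.sphere (0 : EuclideanSpace ℝ (Fin 5)) 1) gN hgN
    W G hG hcpt c Φ hc hsm hinj hco hcl hasym himmΦ hfarΦ c' Ψ hc' hsm' hinj' hco' hcl' hasym'
    himmΨ hfarΨ

end Summit.SmoothPoincare4.SmoothPoincare4.Cruxes.C0AhRecognition.Sketch

end
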